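import Literature.NumberTheory.EllipticCurves.KubertTateFiveEisensteinTwistMinimalModel
import Literature.NumberTheory.EllipticCurves.KubertTate916ShaFive
import Literature.NumberTheory.EllipticCurves.LocalReductionKrausMinimality
import Literature.NumberTheory.EllipticCurves.ComplexMultiplicationLocalFactorsAux
import Mathlib.Tactic.NormNum.Prime
import HarnessLib

/-!
# The Eisenstein twist `E_{9/16}^{(-3)}`: RANK `0`, `t₅ = 0` unconditionally, on its minimal model `[1, 389, −12, −74139, −35685119]` —
# the rank-`0` case of the CLASS-WIDE theorem `cgls_hypotheses_of_model` (`corank_{ℤ₅} Sel_{5^∞} = 0`, `a₅ = -1`)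

PROOF-ONLY file (theorems only, no definition, no named fact, no `sorry`), topic `NumberTheory/EllipticCurves`; a rank-`0` row of the
Eisenstein-twist door obtained through the CLASS-WIDE packaging `KubertTateFiveEisensteinTwistMinimalModel.cgls_hypotheses_of_model` in its
`ω₂(mn) = 0` case (the row `E_{-2/23}^{(-3)}` of `KubertTateM223EisensteinTwist` was done by direct kernel computation instead).  Input:
`E_{9/16} = [7, -144, -2304, 0, 0]` (tree `KubertTate916Descent`: rank `1`, full box, points `(0, 2304)`, `(90, 324)`), Eisenstein tameness
(`Δ = -2²⁰·3¹⁰·1759`, `1759 ≡ 4 (mod 5)`, `≡ 1 (mod 3)`), `mn = 144 = 2⁴·3²` so `ω₂ = 0`, and a globally minimal model of the twist.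

* `W = [1, 389, −12, −74139, −35685119]`, `⟨1, 2, −1/2, 5⟩ • W = E_{9/16}^{(-3)} = [0, 1581/4, 0, −72576, −35831808]`; `W` globally minimal
  (`Δ_W = -2²⁰·3¹⁶·1759`, `2⁴ ∤ c₄`, `3⁴ ∤ c₄`, `c₄ = 5983209`).
* `twist_9_16` — **`rank E_{9/16}^{(-3)}(ℚ) = 0`, `t₅(E_{9/16}^{(-3)}) = 0`, `t₅(E_{9/16}) = 0`** (class-wide `twist_rank_zero_three`);
* `cgls_hypotheses_9_16` — **`Good W 5 ∧ Red W 5 ∧ ¬ Anom W 5 ∧ corank_{ℤ₅} Sel_{5^∞}(W/ℚ) = 0 ∧ rank W(ℚ) = 0`** (class-wide theorem; `a₅(W) = -1`).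

Transfer statement T (stmt-BirchSwinnertonDyer-22356) instrument: with CGLS Thm. E (`r = 0`) + GZK the Summits reading discharges T at `W`.  BSD is
not proved by this.

## References

* [SilvermanAEC2009] J. H. Silverman, *AEC*, 2nd ed., III.1 Table 3.1, VII.1 Remark 1.1, X.§2, Exercise 10.16.
* [Fisher2001FiveSevenDescent] T. Fisher, JEMS 3 (2001), §§1–2.
* [CastellaGrossiLeeSkinner2022] F. Castella, G. Grossi, J. Lee, C. Skinner, Invent. Math. 227 (2022), Thm. E.
* [Kraus1989] A. Kraus, *Quelques remarques à propos des invariants c₄, c₆ et Δ d'une courbe elliptique*, Prop. 2.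
-/

noncomputable section

open scoped Classical
open WeierstrassCurve Literature.NumberTheory.EllipticCurves
open Literature.NumberTheory.EllipticCurves.Rank1Residual.X11RankOneCertificates (discOf c4Of c6Of)
open Literature.NumberTheory.EllipticCurves.Rank1Residual

namespace Literature.NumberTheory.EllipticCurves

namespace KubertTate916EisensteinTwist

/-! ## §1 The base curve `E_{9/16}`: Eisenstein tameness, `ω = 2`, `ω₂ = 0` -/

/-- **Eisenstein tameness of `E_{9/16}`**: bad primes `2, 3, 1759 ≡ 2, 3, 4 (mod 5)`; `1759 ≡ 1 (mod 3)`. [cite: Fisher2001FiveSevenDescent, §2] -/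
theorem eisenstein_tame : ∀ ℓ : ℕ, ℓ.Prime → (ℓ : ℤ) ∣ (kubertTateFive (9 : ℤ) 16).Δ →
    ℓ % 5 ≠ 1 ∧ (ℓ % 5 = 4 → ℓ % 3 = 1) := by
  intro p hp hdvd
  refine ⟨KubertTate916Descent.tame p hp hdvd, fun h4 ↦ ?_⟩
  rw [KubertTate916Descent.Δ_int] at hdvd
  have hdvdN : p ∣ 2 ^ 20 * 3 ^ 10 * 1759 := by
    have h' : (p : ℤ) ∣ ((2 ^ 20 * 3 ^ 10 * 1759 : ℕ) : ℤ) := by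
      have e : ((2 ^ 20 * 3 ^ 10 * 1759 : ℕ) : ℤ) = 108912643670016 := by norm_num
      rw [e]; exact (Int.dvd_neg.mpr hdvd)
    exact Int.natCast_dvd_natCast.mp h'
  have hpi := Nat.Prime.prime hp
  rcases hpi.dvd_or_dvd hdvdN with h | h
  · rcases hpi.dvd_or_dvd h with h | h
    · have := (Nat.prime_dvd_prime_iff_eq hp Nat.prime_two).mp (hpi.dvd_of_dvd_pow h); omega
    · have := (Nat.prime_dvd_prime_iff_eq hp Nat.prime_three).mp (hpi.dvd_of_dvd_pow h); omega
  · have := (Nat.prime_dvd_prime_iff_eq hp (by norm_num : Nat.Prime 1759)).mp h; omega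

/-- `9` and `16` are coprime. [folklore] -/
private theorem isCoprime : IsCoprime (9 : ℤ) 16 := Int.isCoprime_iff_gcd_eq_one.mpr (by norm_num)

/-- `ω(144) = 2` and `ω₂(144) = 0` (`144 = 2⁴·3²`). [folklore] -/
private theorem card_primeFactors :
    (((9 : ℤ) * 16).natAbs.primeFactors).card = 2 ∧ ((((9 : ℤ) * 16).natAbs.primeFactors.filter (fun ℓ ↦ ℓ % 3 = 1))).card = 0 := by
  have e : ((9 : ℤ) * 16).natAbs = 2 ^ 4 * 3 ^ 2 := by norm_num
  rw [e, Nat.primeFactors_mul (by norm_num) (by norm_num), Nat.primeFactors_prime_pow (by norm_num) Nat.prime_two,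
    Nat.primeFactors_prime_pow (by norm_num) Nat.prime_three]
  exact ⟨by decide, by decide⟩

/-- The twist by `-3` is elliptic. [cite: SilvermanAEC2009, X.§2] -/
theorem isElliptic_twist :
    haveI := KubertTate916Descent.isElliptic
    ((kubertTateFive (((9 : ℤ) : ℚ)) (((16 : ℤ) : ℚ))).quadraticTwist (-3)).IsElliptic := by
  haveI := KubertTate916Descent.isElliptic
  exact isElliptic_quadraticTwist _ (by norm_num)

/-! ## §2 The minimal model `W = [1, 389, −12, −74139, −35685119]` -/

/-- **`E_{9/16}^{(-3)} = [0, 1581/4, 0, −72576, −35831808]`** (`b₂ = -527`, `b₄ = -16128`, `b₆ = 5308416`). [cite: SilvermanAEC2009, X.§2] -/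
theorem twist_eq : (kubertTateFive (((9 : ℤ) : ℚ)) (((16 : ℤ) : ℚ))).quadraticTwist (-3) =
    (⟨0, 1581 / 4, 0, -72576, -35831808⟩ : WeierstrassCurve ℚ) := by
  rw [KubertTate916Descent.curve_eq]
  ext <;> simp [quadraticTwist, WeierstrassCurve.b₂, WeierstrassCurve.b₄, WeierstrassCurve.b₆] <;> norm_num

/-- **`⟨1, 2, −1/2, 5⟩ • W = E_{9/16}^{(-3)}`** for the integer model `W = [1, 389, −12, −74139, −35685119]`. [cite: SilvermanAEC2009, III.1 Table 3.1] -/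
theorem variableChange_model :
    (⟨1, 2, -1 / 2, 5⟩ : VariableChange ℚ) •
        (⟨((1 : ℤ) : ℚ), ((389 : ℤ) : ℚ), ((-12 : ℤ) : ℚ), ((-74139 : ℤ) : ℚ), ((-35685119 : ℤ) : ℚ)⟩ : WeierstrassCurve ℚ) =
      (kubertTateFive (((9 : ℤ) : ℚ)) (((16 : ℤ) : ℚ))).quadraticTwist (-3) := by
  rw [twist_eq]
  ext <;> simp [variableChange_a₁, variableChange_a₂, variableChange_a₃, variableChange_a₄, variableChange_a₆] <;> norm_num

/-- The model `W` is elliptic. [cite: SilvermanAEC2009, X.§2] -/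
theorem isElliptic_model :
    (⟨((1 : ℤ) : ℚ), ((389 : ℤ) : ℚ), ((-12 : ℤ) : ℚ), ((-74139 : ℤ) : ℚ), ((-35685119 : ℤ) : ℚ)⟩ : WeierstrassCurve ℚ).IsElliptic := by
  refine ⟨isUnit_iff_ne_zero.mpr ?_⟩
  norm_num [WeierstrassCurve.Δ, WeierstrassCurve.b₂, WeierstrassCurve.b₄, WeierstrassCurve.b₆, WeierstrassCurve.b₈]

/-- `Δ`, `c₄` of the integer model (kernel evaluation). [folklore] -/
private theorem invariants_model :
    discOf [1, 389, -12, -74139, -35685119] = -79397317235441664 ∧ c4Of [1, 389, -12, -74139, -35685119] = 5983209 := by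
  refine ⟨?_, ?_⟩ <;> decide

/-- **`W` is globally minimal**: `Δ_W = -2²⁰·3¹⁶·1759` and `c₄ = 5983209 = 3²·664801` is divisible by neither `2⁴` nor `3⁴`; no other `q¹² ∣ Δ`.
[cite: SilvermanAEC2009, VII.1 Remark 1.1] [cite: Kraus1989, Prop. 2] -/
theorem isGloballyMinimal_model :
    (⟨((1 : ℤ) : ℚ), ((389 : ℤ) : ℚ), ((-12 : ℤ) : ℚ), ((-74139 : ℤ) : ℚ), ((-35685119 : ℤ) : ℚ)⟩ :
      WeierstrassCurve ℚ).IsGloballyMinimal := by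
  obtain ⟨hD, hc4⟩ := invariants_model
  refine WeierstrassCurve.isGloballyMinimal_of_int_kraus 1 389 (-12) (-74139) (-35685119) fun q hq ↦ Or.inl fun h ↦ ?_
  obtain ⟨h12, h4⟩ := h
  rw [hD] at h12
  rw [hc4] at h4
  have hq1 : (q : ℤ) ∣ 79397317235441664 := Int.dvd_neg.mp (dvd_trans (dvd_pow_self _ (by norm_num)) h12)
  have hdvdN : q ∣ 2 ^ 20 * 3 ^ 16 * 1759 := by
    have e : ((2 ^ 20 * 3 ^ 16 * 1759 : ℕ) : ℤ) = 79397317235441664 := by norm_num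
    exact Int.natCast_dvd_natCast.mp (e ▸ hq1)
  have hpi := Nat.Prime.prime hq
  rcases hpi.dvd_or_dvd hdvdN with h | h
  · rcases hpi.dvd_or_dvd h with h | h
    · have := (Nat.prime_dvd_prime_iff_eq hq Nat.prime_two).mp (hpi.dvd_of_dvd_pow h)
      subst this; revert h4; norm_num
    · have := (Nat.prime_dvd_prime_iff_eq hq Nat.prime_three).mp (hpi.dvd_of_dvd_pow h)
      subst this; revert h4; norm_num
  · have := (Nat.prime_dvd_prime_iff_eq hq (by norm_num : Nat.Prime 1759)).mp h
    subst this; revert h12; norm_num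

/-! ## §3 Rank `0`, `t₅ = 0`, and the CGLS hypotheses — by the class-wide theorems -/

/-- **`rank E_{9/16}^{(-3)}(ℚ) = 0`, `t₅(E_{9/16}^{(-3)}/ℚ) = 0`, `t₅(E_{9/16}/ℚ) = 0` — unconditionally** (class-wide `twist_rank_zero_three`; full
`ℚ`-box `rank E = 1 = ω − 1`, `ω₂ = 0`; reference point `(90, 324)`, good prime `7`). [cite: SilvermanAEC2009, Thm. X.4.2 and Exercise 10.16]
[cite: Fisher2001FiveSevenDescent, §2] -/
theorem twist_9_16 :
    haveI := isElliptic_twist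
    ((kubertTateFive (((9 : ℤ) : ℚ)) (((16 : ℤ) : ℚ))).quadraticTwist (-3)).mordellWeilRank = 0 ∧
      ((kubertTateFive (((9 : ℤ) : ℚ)) (((16 : ℤ) : ℚ))).quadraticTwist (-3)).shaCorank 5 = 0 ∧
      (kubertTateFive (((9 : ℤ) : ℚ)) (((16 : ℤ) : ℚ))).shaCorank 5 = 0 := by
  haveI := KubertTate916Descent.isElliptic
  haveI := isElliptic_twist
  haveI : Fact (Nat.Prime 7) := ⟨by norm_num⟩
  have hP : (kubertTateFive (((9 : ℤ) : ℚ)) (((16 : ℤ) : ℚ))).toAffine.Nonsingular 90 324 :=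
    (KubertTate916Descent.nonsingular_iff _ _).mpr (by norm_num)
  obtain ⟨hω, hω₂⟩ := card_primeFactors
  have hr : ((9 : ℤ) * 16).natAbs.primeFactors.card ≤ (kubertTateFive (((9 : ℤ) : ℚ)) (((16 : ℤ) : ℚ))).mordellWeilRank + 1 := by
    rw [hω, KubertTate916Descent.mordellWeilRank_eq]
  exact KubertTateEisensteinTwist.twist_rank_zero_three 9 16 KubertTate916Descent.not_five_dvd_Δ eisenstein_tame hP
    (by norm_num) (by norm_num) 7 (by norm_num) (by norm_num) KubertTate916Descent.not_tor_dvd_Δ hr hω₂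

/-- **THE CGLS INPUT AT `W` (rank-`0` case), from the class-wide theorem**: `Good W 5`, `Red W 5`, `¬ Anom W 5` (`a₅(W) = -a₅(E_{9/16}) = -1`),
**`corank_{ℤ₅} Sel_{5^∞}(W/ℚ) = 0`** and `rank W(ℚ) = 0`. [cite: CastellaGrossiLeeSkinner2022, Thm. E (r = 0)] [cite: SilvermanAEC2009, Exercise 10.16] -/
theorem cgls_hypotheses_9_16 :
    haveI := isGloballyMinimal_model
    haveI := isElliptic_model
    haveI : Fact (Nat.Prime 5) := ⟨Nat.prime_five⟩
    Good (⟨((1 : ℤ) : ℚ), ((389 : ℤ) : ℚ), ((-12 : ℤ) : ℚ), ((-74139 : ℤ) : ℚ), ((-35685119 : ℤ) : ℚ)⟩ : WeierstrassCurve ℚ) 5 ∧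
      Red (⟨((1 : ℤ) : ℚ), ((389 : ℤ) : ℚ), ((-12 : ℤ) : ℚ), ((-74139 : ℤ) : ℚ), ((-35685119 : ℤ) : ℚ)⟩ : WeierstrassCurve ℚ) 5 ∧
      ¬ Anom (⟨((1 : ℤ) : ℚ), ((389 : ℤ) : ℚ), ((-12 : ℤ) : ℚ), ((-74139 : ℤ) : ℚ), ((-35685119 : ℤ) : ℚ)⟩ : WeierstrassCurve ℚ) 5 ∧
      (⟨((1 : ℤ) : ℚ), ((389 : ℤ) : ℚ), ((-12 : ℤ) : ℚ), ((-74139 : ℤ) : ℚ), ((-35685119 : ℤ) : ℚ)⟩ : WeierstrassCurve ℚ).selmerCorank 5 = 0 ∧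
      (⟨((1 : ℤ) : ℚ), ((389 : ℤ) : ℚ), ((-12 : ℤ) : ℚ), ((-74139 : ℤ) : ℚ), ((-35685119 : ℤ) : ℚ)⟩ : WeierstrassCurve ℚ).mordellWeilRank = 0 := by
  haveI := KubertTate916Descent.isElliptic
  haveI := isElliptic_twist
  haveI := isElliptic_model
  haveI := isGloballyMinimal_model
  haveI : Fact (Nat.Prime 5) := ⟨Nat.prime_five⟩
  haveI : Fact (Nat.Prime 7) := ⟨by norm_num⟩
  have hP : (kubertTateFive (((9 : ℤ) : ℚ)) (((16 : ℤ) : ℚ))).toAffine.Nonsingular 90 324 :=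
    (KubertTate916Descent.nonsingular_iff _ _).mpr (by norm_num)
  obtain ⟨hω, hω₂⟩ := card_primeFactors
  have hr : ((9 : ℤ) * 16).natAbs.primeFactors.card ≤ (kubertTateFive (((9 : ℤ) : ℚ)) (((16 : ℤ) : ℚ))).mordellWeilRank + 1 := by
    rw [hω, KubertTate916Descent.mordellWeilRank_eq]
  have hr' : (((9 : ℤ) * 16).natAbs.primeFactors.filter (fun ℓ ↦ ℓ % 3 = 1)).card ≤
      ((kubertTateFive (((9 : ℤ) : ℚ)) (((16 : ℤ) : ℚ))).quadraticTwist (-3)).mordellWeilRank := by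
    rw [hω₂]; exact Nat.zero_le _
  have h := KubertTateEisensteinTwist.cgls_hypotheses_of_model 9 16 isCoprime KubertTate916Descent.not_five_dvd_Δ eisenstein_tame hP
    (by norm_num) (by norm_num) 7 (by norm_num) (by norm_num) KubertTate916Descent.not_tor_dvd_Δ hr hr' _ _ variableChange_model
  rw [hω₂] at h
  exact h

end KubertTate916EisensteinTwist

end Literature.NumberTheory.EllipticCurves

end
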